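import Summits.Ventures.CertifiedManyBodySolver.Downfold.EmeryOrbitalWeightAxis
import Summits.Ventures.CertifiedManyBodySolver.Downfold.EmeryFermiScaleNode
import HarnessLib

/-!
# The SCALE at the Γ–X AXIS point in closed form, a universal window for `t_eff` on every contour, and THE AXIS SCALE LEVER: below the saddle (electron-like surfaces) the
# velocity-matched one-band hopping `t_axis(ε) = fsT·(t_pd² − t_pp′ε)/[(Δ + ε)((t_pd² − t_pp′ε)(Δ + 2ε) + t_pp′ε(Δ + ε))]` is strictly DECREASING in ε_F whenever `t_pp ≤ |t_pd|`

Venture CertifiedManyBodySolver, cell `pub/hubbard-downfold` (stage S1; INFLATION-RULES-3to1-B §B.74 (c) — the scale lever beyond the saddle), seat hubbard-downfold-mod-4 (technique B, g29);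
namespace `Summit.Ventures.CertifiedManyBodySolver.Downfold.Emery`. Sequel of `EmeryOrbitalWeightAxis` (`xAxis`, `charCubic_xAxis`, `dcharCubic_axis_eq/pos`, `xAxis_eq_div`) and
`EmeryFermiScaleNode` (`scaleT_node_eq`, the nodal lever lives in `EmeryFermiScaleLever`). Everything PROVED (0 sorry; the one inequality is a 50-term INTEGER-weight Handelman
certificate in `{t_pd² − t_pp′ε₂, t_pd² − t_pp²}` found by LP — kit job j339314 of this seat — and checked here by `ring` + `positivity`). WHAT THIS IS NOT: a statement about any
material; `U = 0` one-body kinematics of the σ model as printed; no census row sits below the saddle at the fillings of record (theory for overdoped / electron-like surfaces).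

* §1 `scaleAxisN = fsT·(t_pd² − t_pp′ε)`, `scaleAxisD = (Δ + ε)((t_pd² − t_pp′ε)(Δ + 2ε) + t_pp′ε(Δ + ε))`, `dcharCubic_axis_mul` (`(t_pd² − t_pp′ε)·∂_ε charCubic(xAxis, 0) = scaleAxisD`),
  **`scaleT_axis_eq`**: `scaleT(xAxis, 0; ε) = scaleAxisN/scaleAxisD`.
* §2 **`scaleT_mem_uIcc_node_axis`**: for EVERY zone point of EVERY contour in the regime, `t_eff(k) = scaleT(x, y; ε)` lies between `t_node(ε)` and `t_axis(ε)` (the energy denominator is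
  affine in `s = x + y` and `2xNode ≤ s ≤ xAxis`; which end is larger is the sign of `dcharB`, not fixed here).
* §3 **`scaleT_axis_strictAnti`**: `Δ ≥ 0`, `0 ≤ t_pp′ ≤ t_pp`, `t_pp² ≤ t_pd²`, `t_pd ≠ 0`, `0 < ε₁ < ε₂`, `t_pp′ε₂ < t_pd²` ⇒ `t_axis(ε₂) < t_axis(ε₁)` (identity `scaleAxis_cross_eq` +
  certificate `scaleAxisCert`); HONEST: `t_pp ≤ |t_pd|` is a sufficient regime (at `t_pp′ = 0` the exact criterion is `t_pp²Δ² < t_pd²(Δ + ε)² + 6t_pd²t_ppΔ + 8t_pd²t_ppε + 2t_pp²ε²`; for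
  `t_pp ≫ t_pd` the sign fails).

Sources: three-band model [HybertsenSchluterChristensen1989, Eq. (1)]; [AndersenEtAl1995, §6]; Handelman certificates [folklore].
-/

noncomputable section

namespace Summit.Ventures.CertifiedManyBodySolver.Downfold.Emery

open Real Set

/-! ## §1 The axis scale in closed form -/

/-- Numerator of the axis scale: `scaleAxisN = fsT·(t_pd² − t_pp′ε)`. [folklore] -/
def scaleAxisN (Δ tpd tpp c ε : ℝ) : ℝ := fsT Δ tpd tpp c ε * (tpd ^ 2 - c * ε)

/-- Denominator of the axis scale: `scaleAxisD = (Δ + ε)((t_pd² − t_pp′ε)(Δ + 2ε) + t_pp′ε(Δ + ε))`. [folklore] -/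
def scaleAxisD (Δ tpd c ε : ℝ) : ℝ := (Δ + ε) * ((tpd ^ 2 - c * ε) * (Δ + 2 * ε) + c * ε * (Δ + ε))

/-- `(t_pd² − t_pp′ε)·∂_ε charCubic(xAxis, 0; ε) = scaleAxisD` (`t_pd² ≠ t_pp′ε`). [folklore] -/
theorem dcharCubic_axis_mul {Δ tpd tpp c ε : ℝ} (hm : tpd ^ 2 - c * ε ≠ 0) :
    (tpd ^ 2 - c * ε) * dcharCubic Δ tpd tpp c (xAxis Δ tpd c ε) 0 ε = scaleAxisD Δ tpd c ε := by
  have hx4 : 4 * (tpd ^ 2 - c * ε) * xAxis Δ tpd c ε = ε * (Δ + ε) := by unfold xAxis; field_simp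
  rw [dcharCubic_axis_eq, scaleAxisD]
  linear_combination (-(tpd ^ 2 - c * (Δ + 2 * ε))) * hx4

/-- `scaleAxisD > 0` for `Δ + ε > 0`, `ε ≥ 0`, `t_pp′ ≥ 0`, `t_pp′ε < t_pd²`. [folklore] -/
theorem scaleAxisD_pos {Δ tpd c ε : ℝ} (hE : 0 < Δ + ε) (hε : 0 ≤ ε) (hc : 0 ≤ c) (hm : c * ε < tpd ^ 2) : 0 < scaleAxisD Δ tpd c ε := by
  unfold scaleAxisD
  have h1 : 0 < (tpd ^ 2 - c * ε) * (Δ + 2 * ε) := mul_pos (sub_pos.2 hm) (by linarith)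
  have h2 : 0 ≤ c * ε * (Δ + ε) := by positivity
  exact mul_pos hE (by linarith)

/-- **THE AXIS SCALE IN CLOSED FORM**: `scaleT(xAxis, 0; ε) = scaleAxisN/scaleAxisD` (`Δ + ε > 0`, `ε > 0`, `t_pp′ ≥ 0`, `t_pp′ε < t_pd²`). [folklore] -/
theorem scaleT_axis_eq {Δ tpd tpp c ε : ℝ} (hE : 0 < Δ + ε) (hε : 0 < ε) (hc : 0 ≤ c) (hm : c * ε < tpd ^ 2) :
    scaleT Δ tpd tpp c (xAxis Δ tpd c ε) 0 ε = scaleAxisN Δ tpd tpp c ε / scaleAxisD Δ tpd c ε := by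
  have hm' : 0 < tpd ^ 2 - c * ε := sub_pos.2 hm
  have hD := scaleAxisD_pos hE hε.le hc hm
  have hmul := dcharCubic_axis_mul (Δ := Δ) (tpp := tpp) hm'.ne'
  have hW : dcharCubic Δ tpd tpp c (xAxis Δ tpd c ε) 0 ε = scaleAxisD Δ tpd c ε / (tpd ^ 2 - c * ε) := by
    rw [eq_div_iff hm'.ne', mul_comm]; exact hmul
  unfold scaleT
  rw [hW, div_div_eq_mul_div, div_eq_div_iff hD.ne' hD.ne', scaleAxisN]

/-! ## §2 A universal window for the scale on every contour -/

/-- **`t_eff(k)` LIES BETWEEN ITS NODAL AND ITS AXIS VALUE FOR EVERY ZONE POINT OF EVERY CONTOUR** in the regime (`Δ ≥ 0`, `0 ≤ t_pp′ ≤ t_pp`, `t_pp > 0`, `t_pd ≠ 0`, `ε > 0`, `t_pp′ε < t_pd²`):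
the energy denominator is affine in `s = x + y` with `2xNode ≤ s ≤ xAxis` and positive at both ends. [folklore] -/
theorem scaleT_mem_uIcc_node_axis {Δ tpd tpp c x y ε : ℝ} (hΔ : 0 ≤ Δ) (hc : 0 ≤ c) (hct : c ≤ tpp) (htpp : 0 < tpp) (htpd : tpd ≠ 0) (hε : 0 < ε)
    (hm : c * ε < tpd ^ 2) (hx : x ∈ Set.Icc (0 : ℝ) 1) (hy : y ∈ Set.Icc (0 : ℝ) 1) (hP : charCubic Δ tpd tpp c x y ε = 0) :
    scaleT Δ tpd tpp c x y ε ∈ Set.uIcc (scaleT Δ tpd tpp c (xNode Δ tpd tpp c ε) (xNode Δ tpd tpp c ε) ε) (scaleT Δ tpd tpp c (xAxis Δ tpd c ε) 0 ε) := by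
  have hE : 0 < Δ + ε := by linarith
  have hN : 0 < fsN tpd tpp c ε := fsN_pos htpd hc hct htpp hε.le
  have hD : 0 < fsD Δ tpd c ε := fsD_pos hE hm
  have hN1 : fsN1 tpd tpp c ε ≠ 0 := (fsN1_pos hct hε.le htpd).ne'
  have hPn := charCubic_xNode (Δ := Δ) hN1
  have hPa := charCubic_xAxis (Δ := Δ) (tpp := tpp) (sub_pos.2 hm).ne'
  have hWn := dcharCubic_node_pos hΔ hc hct hε htpd
  have hWa := dcharCubic_axis_pos (tpp := tpp) hE hε hc hm
  obtain ⟨hW, -⟩ := dWeight_mem_Icc_node_axis hΔ hc hct htpp htpd hε hm hx hy hP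
  have hlo := (sum_mem_Icc_xNode_yFace hN hD hε.le hN1 hx hy hP).1
  have hhi : x + y ≤ xAxis Δ tpd c ε + 0 := by
    rw [add_zero, xAxis_eq_div hE.ne' (sub_pos.2 hm).ne']; exact sum_le_of_contour_face0 hN hD hx.1 hy.1 hP
  have hT : 0 < fsT Δ tpd tpp c ε := by unfold fsT; positivity
  -- all three denominators are values of ONE affine function of s, positive; fsT/(·) is monotone on the positive axis
  have eW := dcharCubic_eq_affine hN.ne' hP
  have eWn := dcharCubic_eq_affine hN.ne' hPn
  have eWa := dcharCubic_eq_affine hN.ne' hPa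
  unfold scaleT
  set W := dcharCubic Δ tpd tpp c x y ε
  set Wn := dcharCubic Δ tpd tpp c (xNode Δ tpd tpp c ε) (xNode Δ tpd tpp c ε) ε
  set Wa := dcharCubic Δ tpd tpp c (xAxis Δ tpd c ε) 0 ε
  have hWmem : W ∈ Set.uIcc Wn Wa := by
    rw [eW, eWn, eWa]
    exact affine_mem_uIcc _ _ _ _ _ (Set.mem_uIcc.2 (Or.inl ⟨hlo, hhi⟩))
  rcases Set.mem_uIcc.1 hWmem with ⟨h1, h2⟩ | ⟨h1, h2⟩
  · exact Set.mem_uIcc.2 (Or.inr ⟨div_le_div_of_nonneg_left hT.le hW h2, div_le_div_of_nonneg_left hT.le hWn h1⟩)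
  · exact Set.mem_uIcc.2 (Or.inl ⟨div_le_div_of_nonneg_left hT.le hW h2, div_le_div_of_nonneg_left hT.le hWa h1⟩)

/-! ## §3 The axis scale lever -/

/-- Part A of the certificate polynomial of the axis scale lever (25 integer-weighted products; `M₂ = t_pd² − t_pp′ε₂`, `Pp = t_pd² − t_pp²`). [folklore] -/
def scaleAxisCertA (Δ ε₁ d a c h M₂ _Pp : ℝ) : ℝ :=
  4 * d * a ^ 3 * h + 8 * d * a ^ 3 * c + 8 * ε₁ * a ^ 3 * h + 8 * ε₁ * a ^ 3 * c + 2 * ε₁ * d * a ^ 2 * h ^ 2 + ε₁ * d * a ^ 3 +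
  2 * ε₁ ^ 2 * a ^ 2 * h ^ 2 + 10 * Δ * a ^ 3 * h + 16 * Δ * a ^ 3 * c + Δ * d ^ 2 * a * c * h ^ 2 + Δ * d ^ 2 * a * c ^ 3 +
  4 * Δ * ε₁ * a ^ 2 * h ^ 2 + 4 * Δ * ε₁ * a ^ 2 * c * h + 3 * Δ * ε₁ * d * a ^ 2 * c + 2 * Δ * ε₁ ^ 2 * a * c ^ 2 * h + 4 * Δ ^ 2 * a ^ 2 * c * h +
  8 * Δ ^ 2 * a ^ 2 * c ^ 2 + 2 * Δ ^ 2 * d * a ^ 2 * c + 2 * Δ ^ 2 * ε₁ * a * c * h ^ 2 + 4 * Δ ^ 2 * ε₁ * a * c ^ 2 * h + Δ ^ 2 * ε₁ * d * a * c ^ 2 +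
  Δ ^ 3 * d * a * c ^ 2 + 4 * d * a ^ 2 * h * M₂ + 8 * d * a ^ 2 * c * M₂ + 4 * ε₁ * a ^ 2 * h * M₂

/-- Part B of the certificate polynomial of the axis scale lever (25 integer-weighted products). [folklore] -/
def scaleAxisCertB (Δ ε₁ d a c h M₂ Pp : ℝ) : ℝ :=
  10 * ε₁ * a ^ 2 * c * M₂ + 2 * ε₁ * d * a * h ^ 2 * M₂ + 4 * ε₁ * d * a * c * h * M₂ + 6 * ε₁ * d * a * c ^ 2 * M₂ + ε₁ * d * a ^ 2 * M₂ +
  2 * ε₁ ^ 2 * a * h ^ 2 * M₂ + 4 * Δ * a ^ 2 * c * M₂ + 4 * Δ * d * a * c ^ 2 * M₂ + 2 * Δ * d * a ^ 2 * M₂ + Δ * ε₁ * d * a * c * M₂ +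
  2 * Δ * ε₁ ^ 2 * a * c * M₂ + 2 * Δ ^ 2 * a * c ^ 2 * M₂ + Δ ^ 2 * d * a * c * M₂ + 4 * Δ ^ 2 * ε₁ * a * c * M₂ + 2 * Δ ^ 3 * a * c * M₂ +
  Δ * d ^ 2 * a * c * Pp + 4 * ε₁ * a * h * M₂ ^ 2 + 14 * ε₁ * a * c * M₂ ^ 2 + 2 * ε₁ ^ 2 * h ^ 2 * M₂ ^ 2 + 4 * ε₁ ^ 2 * c * h * M₂ ^ 2 +
  2 * Δ * a * h * M₂ ^ 2 + 4 * Δ * a * c * M₂ ^ 2 + 2 * ε₁ ^ 2 * a * M₂ * Pp + 4 * Δ * ε₁ * a * M₂ * Pp + 2 * Δ ^ 2 * a * M₂ * Pp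

/-- **THE CERTIFICATE IDENTITY** (`t_pp = c + h`, `ε₂ = ε₁ + d`): `scaleAxisN(ε₁)·scaleAxisD(ε₂) − scaleAxisN(ε₂)·scaleAxisD(ε₁) = d·(certA + certB)` at
`a = t_pd²`, `M₂ = t_pd² − cε₂`, `Pp = t_pd² − (c + h)²`. [folklore] -/
theorem scaleAxis_cross_eq (Δ tpd c h ε₁ d : ℝ) :
    scaleAxisN Δ tpd (c + h) c ε₁ * scaleAxisD Δ tpd c (ε₁ + d) - scaleAxisN Δ tpd (c + h) c (ε₁ + d) * scaleAxisD Δ tpd c ε₁ =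
      d * (scaleAxisCertA Δ ε₁ d (tpd ^ 2) c h (tpd ^ 2 - c * (ε₁ + d)) (tpd ^ 2 - (c + h) ^ 2) +
        scaleAxisCertB Δ ε₁ d (tpd ^ 2) c h (tpd ^ 2 - c * (ε₁ + d)) (tpd ^ 2 - (c + h) ^ 2)) := by
  unfold scaleAxisN scaleAxisD fsT fsD fsN scaleAxisCertA scaleAxisCertB
  ring

/-- **THE AXIS SCALE LEVER**: `Δ ≥ 0`, `0 ≤ t_pp′ ≤ t_pp`, `t_pp² ≤ t_pd²`, `t_pd ≠ 0`, `0 < ε₁ < ε₂`, `t_pp′ε₂ < t_pd²` ⇒ `t_axis(ε₂) < t_axis(ε₁)` — on electron-like surfaces too, hole doping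
RAISES the velocity-matched one-band `t` at the axis end. [folklore] -/
theorem scaleT_axis_strictAnti {Δ tpd tpp c ε₁ ε₂ : ℝ} (hΔ : 0 ≤ Δ) (hc : 0 ≤ c) (hct : c ≤ tpp) (hp : tpp ^ 2 ≤ tpd ^ 2) (htpd : tpd ≠ 0) (h1 : 0 < ε₁)
    (h12 : ε₁ < ε₂) (hm : c * ε₂ < tpd ^ 2) :
    scaleT Δ tpd tpp c (xAxis Δ tpd c ε₂) 0 ε₂ < scaleT Δ tpd tpp c (xAxis Δ tpd c ε₁) 0 ε₁ := by
  have h2 : 0 < ε₂ := h1.trans h12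
  have hm1 : c * ε₁ < tpd ^ 2 := lt_of_le_of_lt (mul_le_mul_of_nonneg_left h12.le hc) hm
  rw [scaleT_axis_eq (by linarith) h2 hc hm, scaleT_axis_eq (by linarith) h1 hc hm1,
    div_lt_div_iff₀ (scaleAxisD_pos (by linarith) h2.le hc hm) (scaleAxisD_pos (by linarith) h1.le hc hm1), ← sub_pos]
  obtain ⟨h, rfl⟩ : ∃ h, tpp = c + h := ⟨tpp - c, by ring⟩
  obtain ⟨d, rfl⟩ : ∃ d, ε₂ = ε₁ + d := ⟨ε₂ - ε₁, by ring⟩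
  have hh : 0 ≤ h := by linarith
  have hd : 0 < d := by linarith
  have ha : 0 < tpd ^ 2 := by positivity
  have hM : 0 ≤ tpd ^ 2 - c * (ε₁ + d) := by linarith
  have hP : 0 ≤ tpd ^ 2 - (c + h) ^ 2 := by linarith
  rw [scaleAxis_cross_eq]
  have hA : 0 < scaleAxisCertA Δ ε₁ d (tpd ^ 2) c h (tpd ^ 2 - c * (ε₁ + d)) (tpd ^ 2 - (c + h) ^ 2) := by
    unfold scaleAxisCertA; positivity
  have hB : 0 ≤ scaleAxisCertB Δ ε₁ d (tpd ^ 2) c h (tpd ^ 2 - c * (ε₁ + d)) (tpd ^ 2 - (c + h) ^ 2) := by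
    unfold scaleAxisCertB; positivity
  positivity

end Summit.Ventures.CertifiedManyBodySolver.Downfold.Emery
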